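import Summits.ResolutionOfSingularities.ResolutionOfSingularities.Theorems.WeightedInvariantHypersurfaceLocalGameEFT4SDimLEDoorGradedHom
import Summits.ResolutionOfSingularities.ResolutionOfSingularities.Theorems.WeightedInvariantELadderTwoIotaTransport
import HarnessLib

/-!
# E2 tier, (o59-loc) OVER-CENTRE branch at the RING level: the drop `ι T g' < ι A f` read through a cobordant local model

[OURS · L1 W4.3 · door `HypersurfaceCentreConstruction` (stmt-ResolutionOfSingularities-19897) · E2 tier · registrar res-L1-w43-plan-1 ORDER (o58e)
2026-08-27T16:24:23Z (text and 5-line proof recipe of the registrar; names mine) · typed by res-D-pv-056 AS res-L1-w43-stub-5.  Def-free kernel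
algebra, no schemes; `--supports stmt-ResolutionOfSingularities-19897 --as helper`.  Not a statement of [Hironaka2017]; candidates only.]

`iota_lt_of_overCentre_model`: assume (c6) `IotaIsoInvariant ι`, (c-u) `IotaUnitInvariant ι` and the HOM canonical-game clause
`CanonicalGameClauseHomLE 3 p ι J` (p545518).  Let `A` be a regular local ring essentially of finite type over a perfect field of characteristic `p`
with `ringKrullDim A ≤ 3`, `f ∈ 𝔪_A² ∖ {0}`, and let `T` be a local ring with `g' ∈ 𝔪_T²`.  OVER-MODEL PREMISE (= the body of
`Stage.SuccOverCentreAt`, …ELadderTwoCompatible p546537, read at the ring `A` with `J A f` for the stalk filtration; the stalk-map compatibility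
conjunct dropped): for EVERY presentation `(u, w)` of `J A f` as a weighted monomial filtration there are a `t`-homogeneous prime `𝔫` of the
cobordant algebra `B = cobordantAlgebra' u w` containing `t⁻¹`, lying over `𝔪_A`, off the vertex, a ring isomorphism `e : B_𝔫 ≃+* T` and a
factorisation `f = (t⁻¹)^a · g`, `t⁻¹ ∤ g`, with `Associated (e (g/1)) g'`.  CONCLUSION: `ι T g' < ι A f`.  PROOF: the game clause supplies the
centre prime `P ⊆ 𝔪_A` and a presentation `(u, w)` with `WeightedDropHom ι A f P u w`; the premise at that presentation supplies `𝔫, e, a, g`;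
`g/1 ∈ 𝔪_{B_𝔫}²` is `g' ∈ 𝔪_T²` transported along `e` (`IotaTransport.mem_maximalIdeal_sq_iff_of_ringEquiv_of_associated`, p547284);
`WeightedDropHom` gives `ι B_𝔫 (g/1) < ι A f`; and `ι T g' = ι B_𝔫 (g/1)` by `IotaTransport.iota_eq_of_ringEquiv_of_associated`.
Typing note: the `𝔪²`-transport is re-stated here with COMMUTATIVE-SEMIRING binders on the source (`…₀` lemmas) — with `[CommRing A]` the
instance slot is the rigid `CommRing.toCommSemiring _` and its unification with `Localization.instCommSemiring` (the instance the local
models `Localization.AtPrime 𝔫` carry) does not terminate within the default heartbeats; with a semiring binder the slot unifies syntactically.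
-/

noncomputable section

open IsLocalRing Literature.AlgebraicGeometry.Resolution
open Summit.ResolutionOfSingularities.ResolutionOfSingularities.Theorems

set_option linter.dupNamespace false -- mandated namespace of this single-conjunct summit

namespace Summit.ResolutionOfSingularities.ResolutionOfSingularities.Cruxes.HypersurfaceCentreConstruction.LocalEngine

namespace E2OverCentre

/-- Units correspond under a ring isomorphism, hence so does membership in the maximal ideal — COMMUTATIVE-SEMIRING binders on the
source (so that the instance slot unifies with `Localization.instCommSemiring`, the instance the cobordant local models carry). [folklore] -/
theorem apply_mem_maximalIdeal_iff₀ {A T : Type} [CommSemiring A] [IsLocalRing A] [CommSemiring T] [IsLocalRing T] (e : A ≃+* T) (a : A) :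
    e a ∈ maximalIdeal T ↔ a ∈ maximalIdeal A := by
  simp only [IsLocalRing.mem_maximalIdeal, mem_nonunits_iff]
  exact not_congr (MulEquiv.isUnit_map e)

/-- `(𝔪_A).map e = 𝔪_T` for a ring isomorphism of local commutative semirings. [folklore] -/
theorem map_maximalIdeal_ringEquiv₀ {A T : Type} [CommSemiring A] [IsLocalRing A] [CommSemiring T] [IsLocalRing T] (e : A ≃+* T) :
    (maximalIdeal A).map e = maximalIdeal T := by
  ext y
  constructor
  · intro hy
    obtain ⟨x, hx, rfl⟩ := (Ideal.mem_map_of_equiv e y).mp hy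
    exact (apply_mem_maximalIdeal_iff₀ e x).mpr hx
  · intro hy
    exact (Ideal.mem_map_of_equiv e y).mpr ⟨e.symm y, (apply_mem_maximalIdeal_iff₀ e _).mp (by simpa using hy), by simp⟩

/-- **Transport of `∈ 𝔪ⁿ` along a ring isomorphism up to a unit, semiring binders on the source**: `Associated (e x) y`, `y ∈ 𝔪_Tⁿ` ⇒
`x ∈ 𝔪_Aⁿ` (cf. `IotaTransport.mem_maximalIdeal_pow_iff_of_ringEquiv_of_associated`, stated there with `[CommRing A]`). [folklore] -/
theorem mem_maximalIdeal_pow_of_associated₀ {A T : Type} [CommSemiring A] [IsLocalRing A] [CommRing T] [IsLocalRing T]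
    (e : A ≃+* T) {x : A} {y : T} (h : Associated (e x) y) (n : ℕ) (hy : y ∈ (maximalIdeal T) ^ n) :
    x ∈ (maximalIdeal A) ^ n := by
  have hex : e x ∈ (maximalIdeal T) ^ n := (IotaTransport.mem_ideal_iff_of_associated h _).mpr hy
  rw [← map_maximalIdeal_ringEquiv₀ e, ← Ideal.map_pow] at hex
  exact Ideal.apply_mem_of_equiv_iff.mp hex

/-- **(o58e) OVER-CENTRE DROP AT THE RING LEVEL.**  Under (c6), (c-u) and `CanonicalGameClauseHomLE 3 p ι J`, for a position `(A, f)` of the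
canonical game (`A` regular local, essentially of finite type over a perfect field of characteristic `p`, `ringKrullDim A ≤ 3`, `0 ≠ f ∈ 𝔪_A²`),
a local ring `T` with `g' ∈ 𝔪_T²`, and the OVER-MODEL premise (every weighted-monomial presentation of `J A f` is read at a `t`-homogeneous prime of
its cobordant algebra through a ring isomorphism onto `T` carrying `g/1` to an associate of `g'`): `ι T g' < ι A f`. [folklore] -/
theorem iota_lt_of_overCentre_model {p : ℕ} {ι : (R : Type) → [CommRing R] → R → Ordinal.{0}}
    {J : (R : Type) → [CommRing R] → R → ℕ → Ideal R}
    (hiso : IotaIsoInvariant ι) (hunit : IotaUnitInvariant ι) (hgame : CanonicalGameClauseHomLE 3 p ι J)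
    (k₀ : Type) [Field k₀] [CharP k₀ p] [PerfectField k₀]
    {A T : Type} [CommRing A] [CommRing T] [IsLocalRing T] [Algebra k₀ A] [Algebra.EssFiniteType k₀ A] [IsRegularLocalRing A]
    (hdim : ringKrullDim A ≤ 3) (f : A) (hf0 : f ≠ 0) (hf2 : f ∈ (maximalIdeal A) ^ 2) {g' : T} (hg' : g' ∈ (maximalIdeal T) ^ 2)
    (hover : ∀ (n : ℕ) (u : Fin n → A) (w : Fin n → ℕ), (∀ m, weightedMonomialIdeal u w m = J A f m) →
      ∃ (𝔫 : Ideal (cobordantAlgebra' u w)) (_ : 𝔫.IsPrime), IsTHomogeneous u w 𝔫 ∧ cobordantT' u w ∈ 𝔫 ∧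
        (maximalIdeal A).map (algebraMap A (cobordantAlgebra' u w)) ≤ 𝔫 ∧
        ¬ (extReesAlgebra.vertexIdeal (weightedMonomialIdeal u w) ≤ 𝔫) ∧
        ∃ e : Localization.AtPrime 𝔫 ≃+* T, ∃ (a : ℕ) (g : cobordantAlgebra' u w),
          algebraMap A (cobordantAlgebra' u w) f = cobordantT' u w ^ a * g ∧ ¬ (cobordantT' u w ∣ g) ∧
          Associated (e (algebraMap (cobordantAlgebra' u w) (Localization.AtPrime 𝔫) g)) g') :
    ι T g' < ι A f := by
  obtain ⟨P, hP, -, -, -, -, n, u, w, -, -, -, -, hJuw, -, hdrop⟩ := hgame k₀ A f hdim hf0 hf2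
  obtain ⟨𝔫, h𝔫, hT, ht, hm, hv, e, a, g, hfac, hndvd, hassoc⟩ := hover n u w hJuw
  haveI : 𝔫.IsPrime := h𝔫
  have hPmap : P.map (algebraMap A (cobordantAlgebra' u w)) ≤ 𝔫 :=
    (Ideal.map_mono (IsLocalRing.le_maximalIdeal hP.ne_top)).trans hm
  have hmem : algebraMap (cobordantAlgebra' u w) (Localization.AtPrime 𝔫) g ∈ (maximalIdeal (Localization.AtPrime 𝔫)) ^ 2 :=
    @mem_maximalIdeal_pow_of_associated₀ (Localization.AtPrime 𝔫) T (_) (_) _ _ e _ _ hassoc 2 hg'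
  have hlt := hdrop 𝔫 hT ht hPmap hv a g hfac hndvd hmem
  have heq : ι T g' = ι (Localization.AtPrime 𝔫) (algebraMap (cobordantAlgebra' u w) (Localization.AtPrime 𝔫) g) :=
    @IotaTransport.iota_eq_of_ringEquiv_of_associated ι hiso hunit (Localization.AtPrime 𝔫) T (_) (_) e _ _ hassoc
  rw [heq]; exact hlt

end E2OverCentre

end Summit.ResolutionOfSingularities.ResolutionOfSingularities.Cruxes.HypersurfaceCentreConstruction.LocalEngine

end
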